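import Summits.BirchSwinnertonDyer.BirchSwinnertonDyer.Theorems.ErratumRoadFiveEulerHalfGenusShaAnBookkeeping
import HarnessLib

/-!
# Route `ErratumRoadFive`, crux `EulerHalfNotRamNoInertSetAtFive` (item stmt-BirchSwinnertonDyer-19715), served-class road
# `EulerHalfPOnlyMultPotMultTwinAtFive` (idea `ramified-twin-ram-transport`): the genus Gross–Zagier bookkeeping IN X11B3'S
# CURRENCY — the `hbook` interface of the RC descent wrapper

Cell `bsd-stepL` (run/shared/lean/pub/bsd-stepL/), seat `bsd-line-er5-p1-w8` (D-0154 width seat -w8 gen 8 on crux 19715;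
LEAD g7 REVISED-FIT stub (ii), second file — the first, `ErratumRoadFiveEulerHalfGenusShaAnBookkeeping.lean`, is at the
400-line cap), `--supports stmt-BirchSwinnertonDyer-19715`. THEOREMS ONLY (no definition, no named fact, no `sorry`).

`exists_shaAn_padicVal_eq_genus`: the conclusion of `RamifiedTwinRamTransport.exists_rat_shaAn_genus_bookkeeping` (addord's
genus valuation identity with the Tamagawa terms kept: `ord_p #Ш_an(W) + ord_p #Ш_an(A) + ord_p ∏c(W) + ord_p ∏c(A) =
2·ord_p [W(K):ℤP]`) rewritten with the twin's algebraic central value `q_d = L(A,1)/Ω_A` in place of `#Ш_an(A)` —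
`#Ш_an(A) = L(A,1)·#A_tors²/(Ω_A·∏c(A))` in analytic rank `0` — i.e. VERBATIM the conclusion shape of x11b3's
`X11b.exists_shaAn_padicVal_eq_of_heegner` (`ord_p q + ord_p q_d + ord_p ∏c(W) + 2·ord_p #A_tors = 2·ord_p [W(K):ℤP]`,
plus `Ш(W)`, `Ш(W/K)` finite and the Ш-splitting), which seat -w7's RC descent wrapper takes as the hypothesis `hbook`
(STATUS 2026-08-28T21:08Z). HONEST FRAMING: arithmetic glue; conditional on the genus display `hform` and the named facts
GZ I.(7.3), GZK, modularity; closes nothing; BSD is proved for no curve.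
-/

set_option autoImplicit false

noncomputable section

open scoped Classical

open WeierstrassCurve NumberField IsDedekindDomain
  Literature.NumberTheory.EllipticCurves
  Literature.NumberTheory.EllipticCurves.CaiShuTian2014
  Literature.NumberTheory.EllipticCurves.ModularForms
  Literature.NumberTheory.EllipticCurves.Rank1Residual
  Summit.BirchSwinnertonDyer.BirchSwinnertonDyer.Theorems.GenusGrossZagier

-- the cell's Theorems namespace repeats the summit name (Summit.<Summit>.<Problem>), as in every sibling file
set_option linter.dupNamespace false

namespace Summit.BirchSwinnertonDyer.BirchSwinnertonDyer.Theorems.RamifiedTwinRamTransport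

/-! ### The same identity in x11b3's currency (`q_d = L(A,1)/Ω_A`), for the descent wrapper -/

/-- **The genus bookkeeping in the shape of `X11b.exists_shaAn_padicVal_eq_of_heegner`** (the `hbook` interface of
seat -w7's RC descent wrapper `missingUpperBoundAt_of_shaIndexBound_sharp`-RC, STATUS 2026-08-28T21:08Z): with the
twin's algebraic central value `q_d` (`L(A,1)/Ω_A = q_d`, a datum) in place of `#Ш_an(A)`, the identity of
`exists_rat_shaAn_genus_bookkeeping` reads `ord_p #Ш_an(W) + ord_p q_d + ord_p ∏c(W) + 2·ord_p #A(ℚ)_tors =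
2·ord_p [W(K) : ℤP]` — because `#Ш_an(A) = L(A,1)·#A_tors²/(Ω_A·∏c(A))` in analytic rank `0` (`Reg(A) = 1`), so
`ord_p #Ш_an(A) = ord_p q_d + 2·ord_p #A_tors − ord_p ∏c(A)` (modularity `hmod` gives `L(A,1) ≠ 0`, hence `q_d ≠ 0`).
Together with `Ш(W)`, `Ш(W/K)` finite and `ord_p #Ш(W/K) = ord_p #Ш(W) + ord_p #Ш(A)`. Same data and named facts as
`exists_rat_shaAn_genus_bookkeeping`, plus `hmod`. [cite: JetchevSkinnerWan2017, §7.4.1 (eq:gz) and (eq:tamK)]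
[cite: GrossZagier1986, Thm. I.(7.3) and V.§2 (p. 311)] [cite: Miller2011LMS, §1 and Def. 1.1] -/
theorem exists_shaAn_padicVal_eq_genus
    (hGZ73 : GrossZagier1986_thm_I_7_3) (hGZK : rank_eq_analyticRank_of_analyticRank_le_one)
    (hmod : hasEntireLFunction_rat)
    {p : ℕ} [Fact p.Prime] (h5 : 5 ≤ p)
    (E' : WeierstrassCurve ℚ) [E'.IsElliptic] {N : ℕ} [NeZero N]
    (K : Type) [Field K] [NumberField K] (hK : IsImaginaryQuadratic K)
    (Dt : ModularParametrizationData E' N) (hc : ¬ (p : ℤ) ∣ Dt.c)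
    {d₁ d₂ : ℤ} (hd : d₁ * d₂ = NumberField.discr K)
    (W A : WeierstrassCurve ℚ) [W.IsElliptic] [W.IsGloballyMinimal] [A.IsElliptic]
    [A.IsGloballyMinimal] (C₁ C₂ : VariableChange ℚ)
    (hW : C₁ • E'.quadraticTwist (d₁ : ℚ) = W) (hA : C₂ • E'.quadraticTwist (d₂ : ℚ) = A)
    (hu₁ : padicValRat p (C₁.u : ℚ) = 0) (hu₂ : padicValRat p (C₂.u : ℚ) = 0)
    (htwA : ∃ C : VariableChange ℚ, C • W.quadraticTwist (NumberField.discr K : ℚ) = A)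
    (hrW : W.analyticRank = 1) (hrA : A.analyticRank = 0)
    (hirr : Irr W p) (μ : ℕ)
    (P : (W.baseChange K).toAffine.Point) (hP : ¬ IsOfFinAddOrder P)
    (hform : W.leadingLCoeff * A.leadingLCoeff =
      ((((2 : ℝ) ^ μ)⁻¹ * (2 * ZLattice.covolume Dt.L.lattice /
        ((Dt.c : ℝ) ^ 2 * (unitIndex K 1 : ℝ) ^ 2 *
          (((1 : ℕ) : ℝ) * √|(NumberField.discr K : ℝ)|))) : ℝ) : ℂ) *
        ((P.canonicalHeight : ℝ) : ℂ))
    (qd : ℚ) (hqd : A.entireLFunction 1 / (A.realPeriodRat : ℂ) = (qd : ℂ)) :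
    Finite W.sha ∧ Finite (W.baseChange K).sha ∧
      padicValNat p (W.baseChange K).shaOrder = padicValNat p W.shaOrder + padicValNat p A.shaOrder ∧
      ∃ q : ℚ, shaAn W = (q : ℂ) ∧
        padicValRat p q + padicValRat p qd + padicValNat p W.tamagawaProduct +
            2 * padicValNat p A.torsionOrder =
          2 * (padicValNat p (AddSubgroup.zmultiples P).index : ℤ) := by
  obtain ⟨hfinW, -, hfinK, hsha, q, qA, hq, hqA, hval⟩ :=
    exists_rat_shaAn_genus_bookkeeping hGZ73 hGZK h5 E' K hK Dt hc hd W A C₁ C₂ hW hA hu₁ hu₂ htwA hrW hrA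
      hirr μ P hP hform
  refine ⟨hfinW, hfinK, hsha, q, hq, ?_⟩
  -- `#Ш_an(A) = q_d · #A_tors² / ∏c(A)` (analytic rank `0`, `Reg(A) = 1`)
  have hrkA : A.mordellWeilRank = 0 := (hGZK A (hrA.trans_le zero_le_one)).1.trans hrA
  have hRegA : A.regulator = 1 := A.regulator_eq_one_of_rank_zero hrkA
  have hLA : A.leadingLCoeff = A.entireLFunction 1 := by
    rw [WeierstrassCurve.leadingLCoeff, hrA, iteratedDeriv_zero, Nat.factorial_zero, Nat.cast_one, div_one]
  have hL1 : A.entireLFunction 1 ≠ 0 := (A.analyticRank_eq_zero_iff_holds (hmod A)).mp hrA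
  have hΩA : (A.realPeriodRat : ℂ) ≠ 0 := by exact_mod_cast A.realPeriodRat_pos_holds.ne'
  have hLeq : A.entireLFunction 1 = (qd : ℂ) * (A.realPeriodRat : ℂ) := (div_eq_iff hΩA).mp hqd
  have hqd0 : qd ≠ 0 := by
    intro h0
    apply hL1
    rw [hLeq, h0]; simp
  have hcA0 : (A.tamagawaProduct : ℚ) ≠ 0 := by exact_mod_cast A.tamagawaProduct_pos_holds.ne'
  have htA0 : (A.torsionOrder : ℚ) ≠ 0 := by exact_mod_cast A.torsionOrder_pos_holds.ne'
  have hkey : (qA : ℂ) = ((qd * (A.torsionOrder : ℚ) ^ 2 / (A.tamagawaProduct : ℚ) : ℚ) : ℂ) := by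
    have hcAC : (A.tamagawaProduct : ℂ) ≠ 0 := by exact_mod_cast hcA0
    rw [← hqA, shaAn_def, hLA, hRegA, hLeq]
    push_cast
    field_simp
  have hqAeq : qA = qd * (A.torsionOrder : ℚ) ^ 2 / (A.tamagawaProduct : ℚ) := by exact_mod_cast hkey
  have hvA : padicValRat p qA =
      padicValRat p qd + 2 * (padicValNat p A.torsionOrder : ℤ) - padicValNat p A.tamagawaProduct := by
    rw [hqAeq, padicValRat.div (mul_ne_zero hqd0 (pow_ne_zero _ htA0)) hcA0,
      padicValRat.mul hqd0 (pow_ne_zero _ htA0), padicValRat.pow, padicValRat.of_nat, padicValRat.of_nat]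
    push_cast
    ring
  rw [hvA] at hval
  omega

end Summit.BirchSwinnertonDyer.BirchSwinnertonDyer.Theorems.RamifiedTwinRamTransport

end
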